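import Summits.PneNP.PneNP.Theses.SymmetryBudget
import Summits.PneNP.PneNP.Theorems.WindowHam.Negative.InvariantDNFHam
import Summits.PneNP.PneNP.Theorems.WindowBarrier.Negative.InvarianceAndBridge
import Literature.Computability.Complexity.ClayProblem
import Literature.Computability.Complexity.ClayProblemProofs
import Literature.Computability.Complexity.HamCircuitNP

/-!
# `TameCompiles` (stmt-PneNP-14852): the tame branch of the `WindowBarrier` dichotomy feeds `HamCompiles`

Route `PneNP/SymmetryBudget`, support item `TameCompiles : NoHiddenOrder → HamCompiles`
(`Summit.PneNP.PneNP.Theses.SymmetryBudget.TameCompiles`).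

Proof (pure logic over landed tree lemmas, no Literature fact left as a hypothesis):
* `HamCompiles ↔ (NP Bool ⊆ P Bool → ¬ WindowHam)`
  (`WindowHam.Negative.hamCompiles_iff_collapse_imp_not_windowHam`, the "eventually = everywhere"
  patch by the symmetric DNF is already inside that lemma);
* under the collapse `NP Bool ⊆ P Bool`, `HAMCIRCUIT ∈ Classes.P` by the proved model bridges
  `P_bool_eq_holds : PNPWave0.P Bool = Classes.P`, `NP_bool_eq_holds : PNPWave0.NP Bool = NP` and
  `HAMCIRCUIT_mem_NP`;
* then `WindowHam` would give `WindowBarrier` with witness `L = HAMCIRCUIT`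
  (`WindowBarrier.Negative.windowHam_imp_windowBarrier_of_ham_mem_P`), i.e. a `P` language with
  `Bud(m,⌊log₂ m⌋)`-invariant slices that is infinitely often symmetric-hard for every polynomial;
* `NoHiddenOrder` applied to that very `L` yields one polynomial with symmetric circuits for all
  large `m` — `∀ᶠ` against `∃ᶠ ¬`, contradiction.

Sources: doi:10.1007/s00224-016-9692-2 §2.2 (symmetry ⇒ invariance; symmetric DNF), CookClay2006 §1
(Cook's classes over `{0,1}`), Karp1972 §4 (HAM ∈ NP); tree files named above.
-/

set_option linter.dupNamespace false -- `Summit.PneNP.PneNP.…`: summit = sub-problem name (D-0017 single-conjunct layout)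

namespace Summit.PneNP.PneNP.Theorems

open Literature.Computability.Complexity
open Summit.PneNP.PneNP.Theses.SymmetryBudget

/-- **`TameCompiles`** (route `SymmetryBudget`, item stmt-PneNP-14852): "no hidden order at scale
`log m`" implies the equivariant-compilation crux `HamCompiles`. Under `NP Bool ⊆ P Bool` the
language `HAMCIRCUIT` is in `P` (proved model bridges), its graph slices are invariant under every
vertex permutation, so `WindowHam` would make it a `WindowBarrier` witness — which `NoHiddenOrder`
forbids. [folklore] -/
theorem tameCompiles_proof : Summit.PneNP.PneNP.Theses.SymmetryBudget.TameCompiles := by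
  unfold TameCompiles
  intro hN
  rw [WindowHam.Negative.hamCompiles_iff_collapse_imp_not_windowHam]
  intro hsub hW
  have hP : HAMCIRCUIT ∈ Classes.P := by
    have hNP : HAMCIRCUIT ∈ PNPWave0.NP Bool := by
      rw [show PNPWave0.NP Bool = Nondeterministic.NP from NP_bool_eq_holds]
      exact HAMCIRCUIT_mem_NP
    have hPB : HAMCIRCUIT ∈ PNPWave0.P Bool := hsub hNP
    rwa [show PNPWave0.P Bool = Classes.P from P_bool_eq_holds] at hPB
  obtain ⟨L, hL, hinv, hhard⟩ :=
    Summit.PneNP.WindowBarrier.Negative.windowHam_imp_windowBarrier_of_ham_mem_P hP hW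
  obtain ⟨p, hp⟩ := hN L hL hinv
  obtain ⟨m, hm, hm'⟩ := ((hhard p).and_eventually hp).exists
  exact hm hm'

end Summit.PneNP.PneNP.Theorems
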